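/-
Copyright (c) 2026 the pub-hodgecm-mathlib formalisation cell (harness21).  Prover seat hodgecm-mathlib-A-p12 (g22), 2026-09-01.  Road «S3-tree» (architect A-p16 (g30)
A-117 (2) ∕ A-125 (2) «(AS) HOLDER»), brick T3′ «depth-zero κ-transfer», THE TYPE-(2) ASSEMBLY (part 1∕2: the G-side) — over the ★ organs of F0P3a-p04 (g16) (socket, unit row),
F0P2-p06 (g10) (R0²), A-p19 (g26) ∕ B-p14 (g37) ∕ F0P3b-p01 (g12) (R2²), F0P3a-p03 (g15) (H²).
-/
import Literature.NumberTheory.Rogawski1990.DepthZeroKappaTransferTypeTwoSocket                 -- ★ p846003 the type-(2) socket (F0P3a-p04 (g16))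
import Literature.NumberTheory.Rogawski1990.DepthZeroKappaTransferTypeTwoUnitRow                -- ★ p846128 UNIT ROW `hK` (F0P3a-p04 (g16))
import Literature.NumberTheory.Rogawski1990.DepthZeroKappaTransferTypeTwoRowZero                -- ★ p846514 R0² `hK₀` (F0P2-p06 (g10))
import Literature.NumberTheory.Rogawski1990.UnitFundamentalLemmaInertIrredClauseOfValuesStubFrame -- ★ the frame discharges (`exists_isLocalNormPair_of_nonsplit`, `mul_eq_mul_reindex_fromBlocks_of_conj_endoEmbLocal_eq`)
import Literature.NumberTheory.Rogawski1990.LocalStableClassesNonsplitTypeTwoKappa                -- ★ `exists_isStablyConj_finKappaAt_eq_neg`, `finKappaAt_eq_iff_isConj`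
import Literature.NumberTheory.Rogawski1990.DepthZeroKappaTransferTypeOneCounts                   -- ★ p846494 (this seat): the residually-unipotent deepness currency
import Literature.NumberTheory.Automorphic.UnitaryTypeTwoNormPairCentralizerCompact               -- ★ `compactSpace_centralizer_of_isLocalNormPair_of_not_exists_isRoot`
import Literature.NumberTheory.Rogawski1990.FinExplicitTransferFactorDeepTauUniform               -- ★ `eventually_nhds_one_valued_sub_one_le` (F0P3a-p04)
import Literature.NumberTheory.Rogawski1990.FinExplicitTransferFactorLocallyConstant             -- ★ `continuous_fst_localMatrix`
import HarnessLib

/-!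
# T3′ (P-2), TYPE TWO — part 1∕2: the G-side at a depth-zero piece (the type-(2) socket fed with the strata counts of one matched pair), and the
# PUBLIC near-1 package of type (2) (matches are deep; 2×2 depth bookkeeping; the entrywise-deep neighbourhood)

Topic `NumberTheory/Rogawski1990`; namespace `Literature.NumberTheory.Rogawski1990`.  Cell `pub/hodgecm-mathlib`, crux H413; road «S3-tree», brick T3′ «depth-zero κ-transfer»
(DESIGN v2 §2 (P-2), HEAD v4 clause `…_typeTwo`); the clause `depthZeroKappaTransfer_hyperspecial_typeTwo` is part 2∕2 (`DepthZeroKappaTransferTypeTwo.lean`).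
HONEST LABEL: HC_CM is proved only modulo the cell's 2 remaining named inputs (hLiu418 24832, h413 24833) until rung 0 closes; this file asserts nothing printed — it is an
assembly of ★ organs.  THEOREMS ONLY (no definition, no instance, no notation, no named fact, no `sorry`); kernel lane `--supports stmt-HodgeConjecture-24833`.

THE STATEMENT (`finsum_finExplicitDelta_mul_classOrbitalIntegral_depthZero_eq_of_irreducible`).  For a DEEP `G`-regular type-(2) `γ_H` (`χ_{g,w}` rootless in `L_w`; `g_w ≡ 1`,
`u_w ≡ 1 (mod ϖ)` entrywise; `χ(ι_v γ_H)_w` residually `(X−1)³`; exponents `|χ_g(u)|_w = q^{−n}`, `|disc χ_g|_w = q^{−(2N+1)}`, `2 ≤ n ≤ 2N+1`, `n` even or `n = 2N+1`, `1 ≤ N`),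
a depth-zero piece `g` at the hyperspecial vertex and the canonical family `m_G` of a Haar measure `ν_G`:
  `Σᶠ_c Δ‴_v(γ_H, c)·Φ(c, g) = ν_G(K)·((q⁻²c₀ + ((q²−1)∕q²)c₁)·W₂(N−1) + (−q⁻¹c₁ + ((q+1)∕q)c₂)·(W₂(N) − W₂(N−1)))`, `W₂ = phiHtwo q`.
THE PROOF (the (P3)-irreducible template ★ `stableOrbitalIntegralRel_indicator_eq_finsum_finExplicitDelta_of_not_exists_isRoot_of_values`).  A match `b` (★
`exists_isLocalNormPair_of_nonsplit`) with its block frame; the other class `δ₀` (★ `exists_isStablyConj_finKappaAt_eq_neg`); `(δ₊, δ₋)` by the sign of `b` (★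
`finKappaAt_eq_one_or_eq_neg_one_of_isUnit`); every match is deep (`charpoly δ = charpoly ι_v(γ_H)`, ★ `IsLocalNormPair.charpoly_eq`); `np∕nm :=` the strata counts of `δ₊∕δ₋`;
the socket's two values are ★ O8b `classOrbitalIntegral_eq_mul_strata_three_of_deep` at `δ_±`, transported to any match of the same sign by ★ `finKappaAt_eq_iff_isConj`
(same class); rows `hK` ★ p846128, `hK₀` ★ p846514, `hK₂` = the hypothesis `hrow2` (R2², ★ `ncard_rankStrata_two_sub_eq_neg_one_pow_mul` — A-p19 (g26) ∕ F0P3b-p01 (g12) ∕ B-p14 (g37) ∕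
F0P2-p06 (g11) — fed by name by the clause).  The large goal is kept out of the eliminators' motives (`by_contra`).

## References
* [Rogawski1990] J. D. Rogawski, *Automorphic Representations of Unitary Groups in Three Variables*, Ann. of Math. Stud. 123 (1990): §4.9 Prop. 4.9.1 (a)(b) pp. 54–55,
  Lemma 4.9.3 p. 56; §4.3 (4.3.1)–(4.3.2) p. 43; §8.1 Prop. 8.1.1 p. 112.
* [Flicker1998UnitaryFL] Y. Z. Flicker, *Elementary proof of the fundamental lemma for a unitary group*, Canad. J. Math. 50 (1998): Prop. 3 p. 78, Props. 16–17 pp. 96–97,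
  §6 Thm. 18 p. 97.
* [LanglandsShelstad1987] R. P. Langlands, D. Shelstad, *On the definition of transfer factors*, Math. Ann. 278 (1987): §1.3–1.4.
* [Kottwitz1986] R. Kottwitz, *Base change for unit elements of Hecke algebras*, Compositio Math. 60 (1986): §3.
-/

set_option autoImplicit false

noncomputable section

open MeasureTheory Measure Set Function NumberField IsDedekindDomain Matrix Polynomial Topology Filter
open Literature.NumberTheory.Automorphic Literature.NumberTheory.Automorphic.UnitaryGroup
open Literature.NumberTheory.Automorphic.IntegralReduction Literature.NumberTheory.GaloisRepresentations
open Literature.NumberTheory.NumberFields Literature.NumberTheory.QuadraticForms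
open scoped Matrix MatrixGroups ValuativeRel

namespace Literature.NumberTheory.Rogawski1990

variable (L : Type) [Field L] [NumberField L] [IsCMField L] (H' : Matrix (Fin 3) (Fin 3) L)
  {v : HeightOneSpectrum (𝓞 ↥(maximalRealSubfield L))}

/-! ## §1 Every match of a residually-unipotent `γ_H` is deep (PUBLIC) -/

set_option maxHeartbeats 3000000 in  -- the one-place carrier types are large (cold elaboration of the statement)
/-- **Matches of a residually-unipotent `γ_H` are deep**: if `|coeff_i χ(ι_v γ_H)_w − coeff_i χ(1)| < 1` for `i < 3` and `δ` matches `γ_H`, then every coefficient of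
`charpoly(δ_w) − (X−1)³` has valuation `< 1` (`charpoly δ = charpoly ι_v(γ_H)`, ★ `IsLocalNormPair.charpoly_eq`, ★ `charpoly_endoEmbLocal`; `charpoly 1 = (X−1)³`).
[cite: Rogawski1990, §4.3 p. 43; §4.9 p. 54] -/
theorem forall_valuation_coeff_charpoly_sub_lt_one_of_isLocalNormPair (w : PlacesOver L v)
    {γH : ((cmDatum L 2 (Matrix.of fun i j : Fin 2 => if i.val + j.val + 1 = 2 then (1 : L) else 0)).Local v ×
      (cmDatum L 1 (Matrix.of fun i j : Fin 1 => if i.val + j.val + 1 = 1 then (1 : L) else 0)).Local v)}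
    (hdeep : ∀ i < 3, Valued.v (((((endoEmbLocal L v γH).val : GL (Fin 3) (LocalRing L v)) : Matrix (Fin 3) (Fin 3) (LocalRing L v)).map
        (Pi.evalRingHom (fun w' : PlacesOver L v => w'.1.adicCompletion L) w)).charpoly.coeff i - (1 : Matrix (Fin 3) (Fin 3) (w.1.adicCompletion L)).charpoly.coeff i) < 1)
    {δ : (cmDatum L 3 H').Local v} (hδ : IsLocalNormPair L H' v γH δ) (m : ℕ) :
    ValuativeRel.valuation (w.1.adicCompletion L)
      (((((δ.val : GL (Fin 3) (LocalRing L v)).val.map (Pi.evalRingHom (fun w' : UnitaryGroup.PlacesOver L v => w'.1.adicCompletion L) w))).charpoly -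
        (Polynomial.X - 1) ^ 3).coeff m) < 1 := by
  have hiso := ValuativeRel.isEquiv (ValuativeRel.valuation (w.1.adicCompletion L))
    (Valued.v : Valuation (w.1.adicCompletion L) (WithZero (Multiplicative ℤ)))
  rw [hiso.lt_one_iff_lt_one]
  -- `charpoly δ_w = charpoly ι_v(γ_H)_w`
  have hcp : (((δ.val : GL (Fin 3) (LocalRing L v)).val.map (Pi.evalRingHom (fun w' : UnitaryGroup.PlacesOver L v => w'.1.adicCompletion L) w))).charpoly =
      ((((endoEmbLocal L v γH).val : GL (Fin 3) (LocalRing L v)) : Matrix (Fin 3) (Fin 3) (LocalRing L v)).map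
        (Pi.evalRingHom (fun w' : PlacesOver L v => w'.1.adicCompletion L) w)).charpoly := by
    rw [Matrix.charpoly_map, Matrix.charpoly_map, hδ.charpoly_eq, charpoly_endoEmbLocal]
  have h1 : (Polynomial.X - 1 : (w.1.adicCompletion L)[X]) ^ 3 = (1 : Matrix (Fin 3) (Fin 3) (w.1.adicCompletion L)).charpoly := by
    rw [Matrix.charpoly_one, Fintype.card_fin]
  rw [hcp, h1, coeff_sub]
  rcases lt_or_ge m 3 with hm | hm
  · exact hdeep m hm
  · -- both are monic cubics: the coefficients agree from degree `3` on
    have hdA : (((((endoEmbLocal L v γH).val : GL (Fin 3) (LocalRing L v)) : Matrix (Fin 3) (Fin 3) (LocalRing L v)).map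
        (Pi.evalRingHom (fun w' : PlacesOver L v => w'.1.adicCompletion L) w)).charpoly).natDegree = 3 := by
      rw [Matrix.charpoly_natDegree_eq_dim, Fintype.card_fin]
    have hd1 : ((1 : Matrix (Fin 3) (Fin 3) (w.1.adicCompletion L)).charpoly).natDegree = 3 := by rw [Matrix.charpoly_natDegree_eq_dim, Fintype.card_fin]
    rcases hm.eq_or_lt with h3 | h4
    · have hcA := (Matrix.charpoly_monic ((((endoEmbLocal L v γH).val : GL (Fin 3) (LocalRing L v)) : Matrix (Fin 3) (Fin 3) (LocalRing L v)).map
        (Pi.evalRingHom (fun w' : PlacesOver L v => w'.1.adicCompletion L) w))).coeff_natDegree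
      have hc1 := (Matrix.charpoly_monic (1 : Matrix (Fin 3) (Fin 3) (w.1.adicCompletion L))).coeff_natDegree
      rw [hdA] at hcA; rw [hd1] at hc1
      rw [← h3, hcA, hc1, sub_self, map_zero]; exact zero_lt_one
    · rw [Polynomial.coeff_eq_zero_of_natDegree_lt (by rw [hdA]; exact h4), Polynomial.coeff_eq_zero_of_natDegree_lt (by rw [hd1]; exact h4), sub_self, map_zero]
      exact zero_lt_one

/-! ## §2 Entrywise depth one ⇒ `|χ_g(u)| ≤ q⁻²`, `|disc χ_g| ≤ q⁻²`, `tr g ≡ 2`, `det g ≡ 1` (2×2 bookkeeping; PUBLIC) -/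

section TwoByTwo

variable {K : Type*} [Field K] [Valued K (WithZero (Multiplicative ℤ))]

/-- **2×2 bookkeeping at depth one**: if `g ≡ 1` entrywise and `u ≡ 1 (mod ϖ)` (`|·| ≤ e := exp(−1)`), then `|u² − tr g·u + det g| ≤ e²`, `|tr g² − 4 det g| ≤ e²`,
`|tr g − 2| ≤ e` and `|det g − 1| ≤ e` (each expression is a polynomial in the four small quantities `g₀₀−1, g₁₁−1, g₀₁, g₁₀` and `u−1` without constant term,
resp. without terms of degree `< 2`). [cite: Flicker1998UnitaryFL, §6 p. 97] [cite: Rogawski1990, §4.9 p. 55] -/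
theorem valuation_quadratic_bounds_of_entrywise_deep (g : Matrix (Fin 2) (Fin 2) K) (u : K)
    (hg : ∀ i j, Valued.v ((g - 1) i j) ≤ WithZero.exp (-1 : ℤ)) (hu : Valued.v (u - 1) ≤ WithZero.exp (-1 : ℤ)) :
    Valued.v (u ^ 2 - g.trace * u + g.det) ≤ WithZero.exp (-2 : ℤ) ∧
      Valued.v (g.trace ^ 2 - 4 * g.det) ≤ WithZero.exp (-2 : ℤ) ∧
      Valued.v (g.trace - 2) ≤ WithZero.exp (-1 : ℤ) ∧ Valued.v (g.det - 1) ≤ WithZero.exp (-1 : ℤ) := by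
  have h00 : Valued.v (g 0 0 - 1) ≤ WithZero.exp (-1 : ℤ) := by have h := hg 0 0; rwa [Matrix.sub_apply, Matrix.one_apply_eq] at h
  have h11 : Valued.v (g 1 1 - 1) ≤ WithZero.exp (-1 : ℤ) := by have h := hg 1 1; rwa [Matrix.sub_apply, Matrix.one_apply_eq] at h
  have h01 : Valued.v (g 0 1) ≤ WithZero.exp (-1 : ℤ) := by
    have h := hg 0 1; rwa [Matrix.sub_apply, Matrix.one_apply_ne (by decide), sub_zero] at h
  have h10 : Valued.v (g 1 0) ≤ WithZero.exp (-1 : ℤ) := by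
    have h := hg 1 0; rwa [Matrix.sub_apply, Matrix.one_apply_ne (by decide), sub_zero] at h
  have he2 : WithZero.exp (-1 : ℤ) * WithZero.exp (-1 : ℤ) = WithZero.exp (-2 : ℤ) := by rw [← WithZero.exp_add]; norm_num
  have he1 : WithZero.exp (-1 : ℤ) ≤ 1 := by rw [← WithZero.exp_zero, WithZero.exp_le_exp]; norm_num
  have hmul : ∀ {x y : K}, Valued.v x ≤ WithZero.exp (-1 : ℤ) → Valued.v y ≤ WithZero.exp (-1 : ℤ) → Valued.v (x * y) ≤ WithZero.exp (-2 : ℤ) :=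
    fun hx hy => by rw [Valuation.map_mul, ← he2]; exact mul_le_mul' hx hy
  have h4 : Valued.v (4 : K) ≤ 1 := by
    have h := v_natCast_le_one (K := K) 4
    rwa [Nat.cast_ofNat] at h
  refine ⟨?_, ?_, ?_, ?_⟩
  · have e : u ^ 2 - g.trace * u + g.det = (u - 1) * (u - 1) - ((g 0 0 - 1) + (g 1 1 - 1)) * (u - 1) + ((g 0 0 - 1) * (g 1 1 - 1) - g 0 1 * g 1 0) := by
      rw [Matrix.trace_fin_two, Matrix.det_fin_two]; ring
    rw [e]
    refine (Valuation.map_add _ _ _).trans (max_le ((Valuation.map_sub _ _ _).trans (max_le (hmul hu hu) ?_)) ?_)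
    · rw [Valuation.map_mul, ← he2]
      exact mul_le_mul' ((Valuation.map_add _ _ _).trans (max_le h00 h11)) hu
    · exact (Valuation.map_sub _ _ _).trans (max_le (hmul h00 h11) (hmul h01 h10))
  · have e : g.trace ^ 2 - 4 * g.det = ((g 0 0 - 1) - (g 1 1 - 1)) * ((g 0 0 - 1) - (g 1 1 - 1)) + 4 * (g 0 1 * g 1 0) := by
      rw [Matrix.trace_fin_two, Matrix.det_fin_two]; ring
    rw [e]
    refine (Valuation.map_add _ _ _).trans (max_le (hmul ((Valuation.map_sub _ _ _).trans (max_le h00 h11)) ((Valuation.map_sub _ _ _).trans (max_le h00 h11))) ?_)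
    rw [Valuation.map_mul]
    calc Valued.v (4 : K) * Valued.v (g 0 1 * g 1 0) ≤ 1 * WithZero.exp (-2 : ℤ) := mul_le_mul' h4 (hmul h01 h10)
      _ = WithZero.exp (-2 : ℤ) := one_mul _
  · have e : g.trace - 2 = (g 0 0 - 1) + (g 1 1 - 1) := by rw [Matrix.trace_fin_two]; ring
    rw [e]; exact (Valuation.map_add _ _ _).trans (max_le h00 h11)
  · have e : g.det - 1 = (g 0 0 - 1) * (g 1 1 - 1) + ((g 0 0 - 1) + (g 1 1 - 1)) - g 0 1 * g 1 0 := by rw [Matrix.det_fin_two]; ring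
    rw [e]
    refine (Valuation.map_sub _ _ _).trans (max_le ((Valuation.map_add _ _ _).trans (max_le ((hmul h00 h11).trans ?_) ((Valuation.map_add _ _ _).trans (max_le h00 h11))))
      ((hmul h01 h10).trans ?_)) <;>
    · rw [WithZero.exp_le_exp]; norm_num

end TwoByTwo


/-! ## §3 The entrywise-deep neighbourhood of `1 ∈ H_v` (PUBLIC, for the riders: any radius `|c|`) -/

section NearOne

variable (L : Type) [Field L] [NumberField L] [IsCMField L] (v : HeightOneSpectrum (𝓞 ↥(maximalRealSubfield L)))

/-- **`{γ_H | g_w ≡ 1 entrywise and u_w ≡ 1 (mod c)}` IS A NEIGHBOURHOOD OF `1 ∈ H_v`** for every `c ≠ 0` in `L_w` (take `c = ϖ_v^m` for depth `m`): continuity of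
`γ_H ↦ g_w` (★ `continuous_fst_localMatrix`) and of `γ_H ↦ u_w` (★ `eventually_nhds_one_valued_sub_one_le`), closed valuation balls. [cite: Rogawski1990, §4.9 p. 55]
[cite: BernsteinZelevinsky1976, §1.1] -/
theorem setOf_entrywise_deep_mem_nhds_one (w : PlacesOver L v) {c : w.1.adicCompletion L} (hc : c ≠ 0) :
    {γH : ((cmDatum L 2 (Matrix.of fun i j : Fin 2 => if i.val + j.val + 1 = 2 then (1 : L) else 0)).Local v ×
      (cmDatum L 1 (Matrix.of fun i j : Fin 1 => if i.val + j.val + 1 = 1 then (1 : L) else 0)).Local v) |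
      (∀ i j, Valued.v ((((γH.1.val : GL (Fin 2) (LocalRing L v)).val.map (Pi.evalRingHom (fun w' : PlacesOver L v => w'.1.adicCompletion L) w)) - 1) i j) ≤ Valued.v c) ∧
        Valued.v (finGammaTwo L v γH w - 1) ≤ Valued.v c} ∈ 𝓝 (1 : ((cmDatum L 2 (Matrix.of fun i j : Fin 2 => if i.val + j.val + 1 = 2 then (1 : L) else 0)).Local v ×
      (cmDatum L 1 (Matrix.of fun i j : Fin 1 => if i.val + j.val + 1 = 1 then (1 : L) else 0)).Local v)) := by
  have hball : {x : w.1.adicCompletion L | Valued.v x ≤ Valued.v c} ∈ 𝓝 (0 : w.1.adicCompletion L) := by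
    refine Filter.mem_of_superset (Metric.closedBall_mem_nhds (0 : w.1.adicCompletion L) (norm_pos_iff.2 hc)) fun x hx => ?_
    rw [Metric.mem_closedBall, dist_zero_right] at hx
    exact Valued.toNormedField.norm_le_iff.1 hx
  have hcg : Continuous fun γH : ((cmDatum L 2 (Matrix.of fun i j : Fin 2 => if i.val + j.val + 1 = 2 then (1 : L) else 0)).Local v ×
      (cmDatum L 1 (Matrix.of fun i j : Fin 1 => if i.val + j.val + 1 = 1 then (1 : L) else 0)).Local v) =>
      ((γH.1.val.val : Matrix (Fin 2) (Fin 2) (LocalRing L v)).map (Pi.evalRingHom (fun w' : PlacesOver L v => w'.1.adicCompletion L) w)) :=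
    (continuous_fst_localMatrix L v).matrix_map (continuous_apply w)
  have hV₁ : (⋂ i : Fin 2, ⋂ j : Fin 2, (fun γH : ((cmDatum L 2 (Matrix.of fun i j : Fin 2 => if i.val + j.val + 1 = 2 then (1 : L) else 0)).Local v ×
      (cmDatum L 1 (Matrix.of fun i j : Fin 1 => if i.val + j.val + 1 = 1 then (1 : L) else 0)).Local v) =>
      ((((γH.1.val : GL (Fin 2) (LocalRing L v)).val.map (Pi.evalRingHom (fun w' : PlacesOver L v => w'.1.adicCompletion L) w)) - 1) i j)) ⁻¹'
        {x : w.1.adicCompletion L | Valued.v x ≤ Valued.v c}) ∈ 𝓝 (1 : ((cmDatum L 2 (Matrix.of fun i j : Fin 2 => if i.val + j.val + 1 = 2 then (1 : L) else 0)).Local v ×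
      (cmDatum L 1 (Matrix.of fun i j : Fin 1 => if i.val + j.val + 1 = 1 then (1 : L) else 0)).Local v)) := by
    refine Filter.iInter_mem.2 fun i => Filter.iInter_mem.2 fun j => ?_
    have hcont : Continuous fun γH : ((cmDatum L 2 (Matrix.of fun i j : Fin 2 => if i.val + j.val + 1 = 2 then (1 : L) else 0)).Local v ×
      (cmDatum L 1 (Matrix.of fun i j : Fin 1 => if i.val + j.val + 1 = 1 then (1 : L) else 0)).Local v) =>
        ((((γH.1.val : GL (Fin 2) (LocalRing L v)).val.map (Pi.evalRingHom (fun w' : PlacesOver L v => w'.1.adicCompletion L) w)) - 1) i j) :=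
      (hcg.sub continuous_const).matrix_elem i j
    refine hcont.continuousAt.preimage_mem_nhds ?_
    have h0 : ((((1 : ((cmDatum L 2 (Matrix.of fun i j : Fin 2 => if i.val + j.val + 1 = 2 then (1 : L) else 0)).Local v ×
      (cmDatum L 1 (Matrix.of fun i j : Fin 1 => if i.val + j.val + 1 = 1 then (1 : L) else 0)).Local v)).1.val : GL (Fin 2) (LocalRing L v)).val.map
        (Pi.evalRingHom (fun w' : PlacesOver L v => w'.1.adicCompletion L) w)) - 1) i j = 0 := by
      change (((1 : Matrix (Fin 2) (Fin 2) (LocalRing L v)).map (Pi.evalRingHom (fun w' : PlacesOver L v => w'.1.adicCompletion L) w)) - 1) i j = 0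
      rw [Matrix.map_one _ (map_zero _) (map_one _), sub_self, Matrix.zero_apply]
    rw [h0]; exact hball
  have hV₂ := eventually_nhds_one_valued_sub_one_le L v w hc
  refine Filter.mem_of_superset (Filter.inter_mem hV₁ hV₂) fun γH hγ => ?_
  obtain ⟨h1, h2⟩ := hγ
  simp only [Set.mem_iInter, Set.mem_preimage, Set.mem_setOf_eq] at h1 h2 ⊢
  exact ⟨fun i j => h1 i j, h2.1⟩

end NearOne

/-! ## §4 The G-side at a depth-zero piece, type (2) -/

set_option maxHeartbeats 1600000 in  -- the ≈ 60-binder ★ socket ∕ rows ∕ value instantiations (cf. ★ p846003 400000 for the socket alone)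
open scoped Classical in
/-- **THE G-SIDE OF THE TYPE-(2) CLAUSE AT A DEPTH-ZERO PIECE** (see the module docstring): for a deep `G`-regular type-(2) `γ_H` with exponents `(n, N)`, a depth-zero piece `g`
and the canonical family of a Haar measure `ν_G`, `Σᶠ_c Δ‴_v(γ_H, c)·Φ(c, g) = ν_G(K)·((q⁻²c₀ + ((q²−1)∕q²)c₁)·W₂(N−1) + (−q⁻¹c₁ + ((q+1)∕q)c₂)·(W₂(N) − W₂(N−1)))`.
[cite: Rogawski1990, §4.9 Prop. 4.9.1 (a)(b) p. 55; §4.3 (4.3.1)–(4.3.2) p. 43] [cite: Flicker1998UnitaryFL, §6 Thm. 18 p. 97] [cite: Kottwitz1986, §3] -/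
theorem finsum_finExplicitDelta_mul_classOrbitalIntegral_depthZero_eq_of_irreducible
    (hH' : (H'.map (IsCMField.complexConj L))ᵀ = H') (w : PlacesOver L v)
    (hw : IsCMField.complexConj L • w.1 = w.1) (hv : Algebra.IsUnramifiedIn (𝓞 L) v.asIdeal)
    (hH'w : IsUnit (placeForm H' w.1)) (hH'i : hH'w.unit ∈ glInt 3 (w.1.adicCompletion L))
    (μ : HeckeCharacter L) (hμ : μ.IsUnramifiedAt w.1)
    [MeasurableSpace ((cmDatum L 3 H').Local v)] [BorelSpace ((cmDatum L 3 H').Local v)]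
    [∀ γ : ((cmDatum L 3 H').Local v), MeasurableSpace (((cmDatum L 3 H').Local v) ⧸ Subgroup.centralizer ({γ} : Set ((cmDatum L 3 H').Local v)))]
    [∀ γ : ((cmDatum L 3 H').Local v), BorelSpace (((cmDatum L 3 H').Local v) ⧸ Subgroup.centralizer ({γ} : Set ((cmDatum L 3 H').Local v)))]
    (hl : ∀ (v : HeightOneSpectrum (𝓞 ↥(maximalRealSubfield L)))
      (a : ((cmDatum L 2 (Matrix.of fun i j : Fin 2 => if i.val + j.val + 1 = 2 then (1 : L) else 0)).Local v ×
      (cmDatum L 1 (Matrix.of fun i j : Fin 1 => if i.val + j.val + 1 = 1 then (1 : L) else 0)).Local v))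
      (b : (cmDatum L 3 H').Local v)
      (x : ((cmDatum L 2 (Matrix.of fun i j : Fin 2 => if i.val + j.val + 1 = 2 then (1 : L) else 0)).Local v ×
      (cmDatum L 1 (Matrix.of fun i j : Fin 1 => if i.val + j.val + 1 = 1 then (1 : L) else 0)).Local v)),
      finExplicitDelta L v H' (x * a * x⁻¹) μ b = finExplicitDelta L v H' a μ b)
    (hr : ∀ (v : HeightOneSpectrum (𝓞 ↥(maximalRealSubfield L)))
      (a : ((cmDatum L 2 (Matrix.of fun i j : Fin 2 => if i.val + j.val + 1 = 2 then (1 : L) else 0)).Local v ×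
      (cmDatum L 1 (Matrix.of fun i j : Fin 1 => if i.val + j.val + 1 = 1 then (1 : L) else 0)).Local v))
      (b y : (cmDatum L 3 H').Local v),
      finExplicitDelta L v H' a μ (y * b * y⁻¹) = finExplicitDelta L v H' a μ b)
    (hH'u : IsUnit H')
    (hμω : ∀ x : ideleGroup ↥(maximalRealSubfield L), μ (AdeleRing.ideleBaseChange ↥(maximalRealSubfield L) L x) = quadraticHeckeCharCM L x)
    (h2 : IsUnit (2 : 𝒪[w.1.adicCompletion L]))
    {γH : ((cmDatum L 2 (Matrix.of fun i j : Fin 2 => if i.val + j.val + 1 = 2 then (1 : L) else 0)).Local v ×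
      (cmDatum L 1 (Matrix.of fun i j : Fin 1 => if i.val + j.val + 1 = 1 then (1 : L) else 0)).Local v)}
    (hreg : IsLocalGRegular L v γH)
    (hirr : ¬ ∃ x : w.1.adicCompletion L, (((γH.1.val : GL (Fin 2) (LocalRing L v)).val.map
        (Pi.evalRingHom (fun w' : PlacesOver L v => w'.1.adicCompletion L) w)).charpoly).IsRoot x)
    (hint : ∀ i : ℕ, ((((endoEmbLocal L v γH).val : GL (Fin 3) (LocalRing L v)).val.map
        (Pi.evalRingHom (fun w' : PlacesOver L v => w'.1.adicCompletion L) w)).charpoly.coeff i) ∈ 𝒪[w.1.adicCompletion L])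
    (hdeep : ∀ i < 3, Valued.v (((((endoEmbLocal L v γH).val : GL (Fin 3) (LocalRing L v)) : Matrix (Fin 3) (Fin 3) (LocalRing L v)).map
        (Pi.evalRingHom (fun w' : PlacesOver L v => w'.1.adicCompletion L) w)).charpoly.coeff i - (1 : Matrix (Fin 3) (Fin 3) (w.1.adicCompletion L)).charpoly.coeff i) < 1)
    (n N : ℕ)
    (hn : Valued.v (((finCharpolyTwo L v γH).eval (finGammaTwo L v γH)) w) = WithZero.exp (-(n : ℤ)))
    (hN : Valued.v (((γH.1.val : GL (Fin 2) (LocalRing L v)).val.map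
        (Pi.evalRingHom (fun w' : PlacesOver L v => w'.1.adicCompletion L) w)).trace ^ 2 -
      4 * ((γH.1.val : GL (Fin 2) (LocalRing L v)).val.map
        (Pi.evalRingHom (fun w' : PlacesOver L v => w'.1.adicCompletion L) w)).det) = WithZero.exp (-((2 * N + 1 : ℕ) : ℤ)))
    (hn2 : 2 ≤ n) (hN1 : 1 ≤ N) (hnN : n ≤ 2 * N + 1) (hpar : Even n ∨ n = 2 * N + 1)
    (hg1 : ∀ i j, Valued.v ((((γH.1.val : GL (Fin 2) (LocalRing L v)).val.map (Pi.evalRingHom (fun w' : PlacesOver L v => w'.1.adicCompletion L) w)) - 1) i j) ≤ WithZero.exp (-1 : ℤ))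
    (hu1 : Valued.v (finGammaTwo L v γH w - 1) ≤ WithZero.exp (-1 : ℤ))
    -- R2², the FREE ROW of the socket, as a hypothesis (★ `ncard_rankStrata_two_sub_eq_neg_one_pow_mul` by name at the call site)
    (hrow2 : ∀ δp : (cmDatum L 3 H').Local v, IsLocalNormPair L H' v γH δp → finKappaAt L v H' γH δp = 1 →
      (∀ m : ℕ, ValuativeRel.valuation (w.1.adicCompletion L)
        (((((δp.val : GL (Fin 3) (LocalRing L v)).val.map (Pi.evalRingHom (fun w' : UnitaryGroup.PlacesOver L v => w'.1.adicCompletion L) w))).charpoly -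
          (Polynomial.X - 1) ^ 3).coeff m) < 1) →
      ∀ δm : (cmDatum L 3 H').Local v, IsLocalNormPair L H' v γH δm → finKappaAt L v H' γH δm = -1 →
      (∀ m : ℕ, ValuativeRel.valuation (w.1.adicCompletion L)
        (((((δm.val : GL (Fin 3) (LocalRing L v)).val.map (Pi.evalRingHom (fun w' : UnitaryGroup.PlacesOver L v => w'.1.adicCompletion L) w))).charpoly -
          (Polynomial.X - 1) ^ 3).coeff m) < 1) →
      (({q : (cmDatum L 3 H').Local v ⧸ cmLocalIntegralLevel L 3 H' v |
          q ∈ MulAction.fixedBy ((cmDatum L 3 H').Local v ⧸ cmLocalIntegralLevel L 3 H' v) δp ∧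
            (redMat ((((q.out⁻¹ * δp * q.out : (cmDatum L 3 H').Local v)).val : GL (Fin 3) (LocalRing L v)).val.map
              (Pi.evalRingHom (fun w' : UnitaryGroup.PlacesOver L v => w'.1.adicCompletion L) w)) - 1).rank = 2}.ncard : ℕ) : ℚ) -
        (({q : (cmDatum L 3 H').Local v ⧸ cmLocalIntegralLevel L 3 H' v |
          q ∈ MulAction.fixedBy ((cmDatum L 3 H').Local v ⧸ cmLocalIntegralLevel L 3 H' v) δm ∧
            (redMat ((((q.out⁻¹ * δm * q.out : (cmDatum L 3 H').Local v)).val : GL (Fin 3) (LocalRing L v)).val.map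
              (Pi.evalRingHom (fun w' : UnitaryGroup.PlacesOver L v => w'.1.adicCompletion L) w)) - 1).rank = 2}.ncard : ℕ) : ℚ) =
        (-1 : ℚ) ^ n * ((Ideal.absNorm v.asIdeal : ℚ) + 1) * (Ideal.absNorm v.asIdeal : ℚ) ^ (N + n - 1))
    (νG : Measure ((cmDatum L 3 H').Local v)) [νG.IsHaarMeasure] [νG.IsMulRightInvariant]
    {mG : OrbitalMeasureFamily ((cmDatum L 3 H').Local v)}
    (hmG : mG.IsCanonical (fun γ => IsRegularElt (γ.val : GL (Fin 3) (UnitaryGroup.LocalRing L v))) νG)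
    (g : ((cmDatum L 3 H').Local v) → ℂ) (hg : IsLocSmooth g) (hgK : tsupport g ⊆ (cmLocalIntegralLevel L 3 H' v : Set ((cmDatum L 3 H').Local v)))
    (hginv : ∀ u ∈ cmLocalIntegralLevel L 3 H' v, ∀ x, g (u * x * u⁻¹) = g x)
    (c : ℕ → ℂ)
    (hc : ∀ k ∈ cmLocalIntegralLevel L 3 H' v,
      (redMat (((k.val : GL (Fin 3) (UnitaryGroup.LocalRing L v)).val.map (Pi.evalRingHom (fun w' : PlacesOver L v => w'.1.adicCompletion L) w))) - 1) ^ 3 = 0 →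
      g k = c (redMat (((k.val : GL (Fin 3) (UnitaryGroup.LocalRing L v)).val.map (Pi.evalRingHom (fun w' : PlacesOver L v => w'.1.adicCompletion L) w))) - 1).rank) :
    ∑ᶠ cG : ConjClasses ((cmDatum L 3 H').Local v),
        (finExplicitCollection L H' μ hl hr v).Δ γH (Quotient.out cG) * classOrbitalIntegral mG g cG =
      (νG.real (cmLocalIntegralLevel L 3 H' v : Set ((cmDatum L 3 H').Local v)) : ℂ) *
        (((((Ideal.absNorm v.asIdeal : ℂ)) ^ 2)⁻¹ * c 0 + ((((Ideal.absNorm v.asIdeal : ℂ)) ^ 2 - 1) / ((Ideal.absNorm v.asIdeal : ℂ)) ^ 2) * c 1) *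
          ((Flicker1998.phiHtwo (Ideal.absNorm v.asIdeal) (N - 1) : ℚ) : ℂ) +
        (-((Ideal.absNorm v.asIdeal : ℂ))⁻¹ * c 1 + ((((Ideal.absNorm v.asIdeal : ℂ)) + 1) / ((Ideal.absNorm v.asIdeal : ℂ))) * c 2) *
          ((Flicker1998.phiHtwo (Ideal.absNorm v.asIdeal) N - Flicker1998.phiHtwo (Ideal.absNorm v.asIdeal) (N - 1) : ℚ) : ℂ)) := by
  have hq : 1 < Ideal.absNorm v.asIdeal :=
    Nat.one_lt_iff_ne_zero_and_ne_one.2 ⟨by rw [Ne, Ideal.absNorm_eq_zero_iff]; exact v.ne_bot,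
      by rw [Ne, Ideal.absNorm_eq_one_iff]; exact v.isPrime.ne_top⟩
  have hH'c : (H'.map (cmConjRingHom L))ᵀ = H' := by
    have e1 : H'.map (cmConjRingHom L) = H'.map (IsCMField.complexConj L) := by
      ext i j; simp [Matrix.map_apply, cmConjRingHom_apply]
    rw [e1]; exact hH'
  have hdet : H'.det ≠ 0 := (Matrix.isUnit_iff_isUnit_det _ |>.1 hH'u).ne_zero
  -- keep the (large) goal out of the eliminators' motives while gathering the frame; it comes back at `exact hneg …`
  by_contra hneg
  -- (1) a match `b` with its block frame, `χ_g` irreducible, `χ_g(u)` a unit, the local hermitian data (as ★ the (P3)-irreducible stub frame)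
  obtain ⟨b, h⟩ := exists_isLocalNormPair_of_nonsplit L H' hH' w hw hv hH'w hH'i γH
  have hA : Irreducible ((γH.1.val : GL (Fin 2) (UnitaryGroup.LocalRing L v)).val.charpoly) :=
    irreducible_charpoly_of_not_exists_isRoot_eval L v w hw _ hirr
  obtain ⟨δ₁, hcδ, hδ⟩ : ∃ δ : L, IsCMField.complexConj L δ = -δ ∧ δ ≠ 0 := by
    obtain ⟨ζ, hζ⟩ := not_forall.1 fun h0 => IsCMField.complexConj_ne_one L (AlgEquiv.ext h0)
    refine ⟨ζ - IsCMField.complexConj L ζ, by rw [map_sub, IsCMField.complexConj_apply_apply, neg_sub], fun h0 => hζ ?_⟩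
    rw [sub_eq_zero] at h0
    exact h0.symm
  have hF := Liu2021.LemD1IndexedNonVacuityNonsplitPlace.isField_localRing_of_nonsplit L v (IsCMField.complexConj L) hcδ hδ w hw
  have hu : IsUnit ((finCharpolyTwo L v γH).eval (finGammaTwo L v γH)) := by
    have hne : (finCharpolyTwo L v γH).eval (finGammaTwo L v γH) ≠ 0 := by
      letI : Field (UnitaryGroup.LocalRing L v) := hF.toField
      exact Literature.LinearAlgebra.Matrix.eval_charpoly_ne_zero_of_irreducible hA (by simp) _
    obtain ⟨y, hy⟩ := hF.mul_inv_cancel hne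
    exact IsUnit.of_mul_eq_one _ hy
  have hH := map_conjLocal_transpose_localForm L 3 H' v hH'c
  have hHd := isUnit_det_localForm L 3 H' v hdet
  obtain ⟨cj, hcj⟩ := isConj_iff.1 h
  have hP := mul_eq_mul_reindex_fromBlocks_of_conj_endoEmbLocal_eq L H' γH hcj
  -- (2) the other class and the signed pair `(δ₊, δ₋)`
  obtain ⟨δ₀, hst₀, -, hκ₀⟩ := exists_isStablyConj_finKappaAt_eq_neg L v H' γH b w hw h hu hH hHd endoPerm hP hA
  have hδ₀ : IsLocalNormPair L H' v γH δ₀ := isLocalNormPair_of_mk_mem_conjClassesIn L v H' γH b h (mk_mem_conjClassesIn_iff.2 hst₀)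
  obtain ⟨δp, δm, hp, hκp, hm, hκm⟩ : ∃ δp δm : (cmDatum L 3 H').Local v,
      IsLocalNormPair L H' v γH δp ∧ finKappaAt L v H' γH δp = 1 ∧ IsLocalNormPair L H' v γH δm ∧ finKappaAt L v H' γH δm = -1 := by
    rcases finKappaAt_eq_one_or_eq_neg_one_of_isUnit L v H' γH b h hu with hκ | hκ
    · exact ⟨b, δ₀, h, hκ, hδ₀, by rw [hκ₀, hκ]⟩
    · exact ⟨δ₀, b, hδ₀, by rw [hκ₀, hκ]; norm_num, h, hκ⟩
  -- every match is deep, regular, with compact centraliser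
  have hdeepδ := fun (δ : (cmDatum L 3 H').Local v) (hδ : IsLocalNormPair L H' v γH δ) =>
    forall_valuation_coeff_charpoly_sub_lt_one_of_isLocalNormPair L H' w hdeep hδ
  have hregp : IsRegularElt (δp.val : GL (Fin 3) (LocalRing L v)) := isRegularElt_of_isLocalNormPair L H' v hp hreg
  haveI : CompactSpace (Subgroup.centralizer ({δp} : Set ((cmDatum L 3 H').Local v))) :=
    compactSpace_centralizer_of_isLocalNormPair_of_not_exists_isRoot L v w hw hH'u hv hreg h2 hint hirr N hN δp hp
  have hregm : IsRegularElt (δm.val : GL (Fin 3) (LocalRing L v)) := isRegularElt_of_isLocalNormPair L H' v hm hreg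
  haveI : CompactSpace (Subgroup.centralizer ({δm} : Set ((cmDatum L 3 H').Local v))) :=
    compactSpace_centralizer_of_isLocalNormPair_of_not_exists_isRoot L v w hw hH'u hv hreg h2 hint hirr N hN δm hm
  -- the frames of `δ₊`, `δ₋` (for ★ `finKappaAt_eq_iff_isConj`)
  obtain ⟨cp, hcp⟩ := isConj_iff.1 hp
  have hPp := mul_eq_mul_reindex_fromBlocks_of_conj_endoEmbLocal_eq L H' γH hcp
  obtain ⟨cm, hcm⟩ := isConj_iff.1 hm
  have hPm := mul_eq_mul_reindex_fromBlocks_of_conj_endoEmbLocal_eq L H' γH hcm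
  -- (3) the values of the piece at `δ₊`, `δ₋` (★ O8b)
  have hvalp := classOrbitalIntegral_eq_mul_strata_three_of_deep L v w hw νG hH'c hdet hmG δp hregp (hdeepδ δp hp) g hg hgK hginv c hc
  have hvalm := classOrbitalIntegral_eq_mul_strata_three_of_deep L v w hw νG hH'c hdet hmG δm hregm (hdeepδ δm hm) g hg hgK hginv c hc
  -- the strata-count functions of the socket
  let nS : ((cmDatum L 3 H').Local v) → ℕ → ℕ := fun t r => {q : (cmDatum L 3 H').Local v ⧸ cmLocalIntegralLevel L 3 H' v |
          q ∈ MulAction.fixedBy ((cmDatum L 3 H').Local v ⧸ cmLocalIntegralLevel L 3 H' v) t ∧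
            (redMat ((((q.out⁻¹ * t * q.out : (cmDatum L 3 H').Local v)).val : GL (Fin 3) (LocalRing L v)).val.map
              (Pi.evalRingHom (fun w' : UnitaryGroup.PlacesOver L v => w'.1.adicCompletion L) w)) - 1).rank = r}.ncard
  -- (4) the three rows
  have hK := sum_ncard_rankStrata_sub_eq_neg_pow_mul_phiHtwo L H' hH' w hw hv hH'w hH'i hH'u h2 hreg hint hirr n N hn hN hnN hpar hq
    δp hp hκp (hdeepδ δp hp) δm hm hκm (hdeepδ δm hm)
  have hK₀ := ncard_rankStrata_zero_sub_eq_neg_pow_mul_phiHtwo L H' hH' w hw hv hH'w hH'i hH'u h2 hreg hirr n N hn hN hn2 hN1 hnN hpar hq hg1 hu1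
    δp hp hκp δm hm hκm
  have hK₂ := hrow2 δp hp hκp (hdeepδ δp hp) δm hm hκm (hdeepδ δm hm)
  have hnlog : WithZero.log (Valued.v (((finCharpolyTwo L v γH).eval (finGammaTwo L v γH)) w)) = -(n : ℤ) := by rw [hn, WithZero.log_exp]
  -- (5) the socket
  have hsock := finsum_finExplicitDelta_mul_classOrbitalIntegral_eq_of_irreducible_of_strata L v H' γH b w hw μ hμω hv hμ hl hr h hu hH hHd endoPerm hP hA mG g
    n N hnlog hn2 hN1 hq (νG.real (cmLocalIntegralLevel L 3 H' v : Set ((cmDatum L 3 H').Local v)) : ℂ) c (nS δp) (nS δm)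
    (by push_cast at hK ⊢; exact hK) hK₀ hK₂
    (fun δ hδ hκ => by
      -- same sign ⇒ same class as `δ₊` ⇒ same value
      have hst : IsStablyConj (UnitaryGroup.conjLocal L (IsCMField.complexConj L) v) ((UnitaryGroup.adelicForm L 3 H').map (UnitaryGroup.adeleToLocal L v))
          ⟨δp.val, δp.2⟩ ⟨δ.val, δ.2⟩ := by
        have h1 := hp; have h2' := hδ
        rw [isLocalNormPair_iff] at h1 h2'
        exact h1.isStablyConj_right h2'
      obtain ⟨gδ, hgδ⟩ := isStablyConj_iff.1 hst
      have hconj := (finKappaAt_eq_iff_isConj L v H' γH δp δ w hw hp hu hH hHd endoPerm hPp hA hgδ).1 (hκ.trans hκp.symm)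
      have hmk : ConjClasses.mk δ = ConjClasses.mk δp := (ConjClasses.mk_eq_mk_iff_isConj.2 hconj).symm
      rw [hmk, hvalp])
    (fun δ hδ hκ => by
      have hst : IsStablyConj (UnitaryGroup.conjLocal L (IsCMField.complexConj L) v) ((UnitaryGroup.adelicForm L 3 H').map (UnitaryGroup.adeleToLocal L v))
          ⟨δm.val, δm.2⟩ ⟨δ.val, δ.2⟩ := by
        have h1 := hm; have h2' := hδ
        rw [isLocalNormPair_iff] at h1 h2'
        exact h1.isStablyConj_right h2'
      obtain ⟨gδ, hgδ⟩ := isStablyConj_iff.1 hst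
      have hconj := (finKappaAt_eq_iff_isConj L v H' γH δm δ w hw hm hu hH hHd endoPerm hPm hA hgδ).1 (hκ.trans hκm.symm)
      have hmk : ConjClasses.mk δ = ConjClasses.mk δm := (ConjClasses.mk_eq_mk_iff_isConj.2 hconj).symm
      rw [hmk, hvalm])
  exact hneg hsock

end Literature.NumberTheory.Rogawski1990

end
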